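import Mathlib
import Summits.MatrixMultiplication.MatrixMultiplication.Theorems.GradedDesignFamily.Negative.SubfieldCellNonGeneration
import Summits.MatrixMultiplication.MatrixMultiplication.Theorems.GradedDesignFamily.Negative.SubfieldCellDensePiece

/-!
# Subfield cell — (S′): the SLICED conclusion of the structure dichotomy from (P1) ∧ (BGT) ∧ (P4),
# WITHOUT Dickson (route (D′); crux `LevelGradedCohnUmans.GradedDesignFamily`,
# stmt-MatrixMultiplication-7610; negative side, unit b2b-lgcu-subfield gen 19)

HONEST FRAMING.  `structureSliced_of_pieces` is the Dickson-free replacement of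
`structureDichotomy_of_pieces` (`SubfieldCellStructure.lean`): for an `M`-approximate subgroup
`A ⊆ GL₂(K)` with `c₁|K|³ ≤ |A| ≤ c₂|K|³` which moreover CONTROLS `φ(SL₂ k)·Y ⊆ X·A`
(`|X| ≤ M`, `φ : SL₂(k) →* GL₂(K)` injective, `|K| = |k|²`), `det` takes `≤ m₀` values on `A`.
The generating case is (BGT) + (P4) exactly as before; in the non-generating case a dense piece of
`φ(SL₂ k)` conjugates into `⟨A⁴ ∩ SL₂⟩` (`densePiece_of_subset_mul`) and (NG)
(`subfieldCell_nonGeneration`) forces generation — no classification of subgroups of `SL₂(K)` is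
used.  A step in the NEGATIVE decision of the design stub S3; NOT summit progress.

Sorry-free. [folklore]
-/

set_option linter.dupNamespace false

open scoped Pointwise

namespace Summit.MatrixMultiplication.MatrixMultiplication.Theorems.GradedDesignFamily.Negative

/-- **(S′) from (P1) ∧ (BGT) ∧ (P4)** (and the in-tree (NG)).  NOT summit progress.
[cite: BreuillardGreenTao2011, Thm 1.3] -/
theorem structureSliced_of_pieces
    (hP1 : ∀ (K : Type) [Field K] [Fintype K] [DecidableEq K]
      (A : Finset (Matrix.GeneralLinearGroup (Fin 2) K)), A.Nonempty →
      (↑A : Set (Matrix.GeneralLinearGroup (Fin 2) K))⁻¹ = ↑A →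
      A.card ≤ (Fintype.card K - 1) *
        ((A ^ 2).filter fun g => Matrix.GeneralLinearGroup.det g = 1).card)
    (hBGT : ∃ C : ℝ → ℝ, ∀ K₀ : ℝ, 1 ≤ C K₀ ∧
      ∀ (K : Type) [Field K] [Fintype K] [DecidableEq K]
        (B : Finset (Matrix.GeneralLinearGroup (Fin 2) K)),
        (∀ b ∈ B, Matrix.GeneralLinearGroup.det b = 1) →
        IsApproximateSubgroup K₀ (B : Set (Matrix.GeneralLinearGroup (Fin 2) K)) →
        Subgroup.closure (B : Set (Matrix.GeneralLinearGroup (Fin 2) K)) =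
          (Matrix.GeneralLinearGroup.det : Matrix.GeneralLinearGroup (Fin 2) K →* Kˣ).ker →
        (B.card : ℝ) ≤ C K₀ ∨
          (Nat.card (Matrix.GeneralLinearGroup.det :
              Matrix.GeneralLinearGroup (Fin 2) K →* Kˣ).ker : ℝ) ≤ C K₀ * B.card)
    (hP4 : ∀ M c₂ C : ℝ, 1 ≤ M → 0 < c₂ → 0 < C → ∃ m₀ Q₆ : ℕ,
      ∀ (K : Type) [Field K] [Fintype K] [DecidableEq K], Q₆ ≤ Fintype.card K →
        ∀ A : Finset (Matrix.GeneralLinearGroup (Fin 2) K),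
          IsApproximateSubgroup M (A : Set (Matrix.GeneralLinearGroup (Fin 2) K)) →
          (A.card : ℝ) ≤ c₂ * (Fintype.card K : ℝ) ^ 3 →
          (Nat.card (Matrix.GeneralLinearGroup.det :
              Matrix.GeneralLinearGroup (Fin 2) K →* Kˣ).ker : ℝ) ≤
            C * ((A ^ 4).filter fun g => Matrix.GeneralLinearGroup.det g = 1).card →
          (A.image Matrix.GeneralLinearGroup.det).card ≤ m₀) :
    ∀ M c₁ c₂ : ℝ, 1 ≤ M → 0 < c₁ → 0 < c₂ → ∃ m₀ Q₂ : ℕ,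
      ∀ (k K : Type) [Field k] [Fintype k] [DecidableEq k] [Field K] [Fintype K] [DecidableEq K]
        (φ : Matrix.SpecialLinearGroup (Fin 2) k →* Matrix.GeneralLinearGroup (Fin 2) K),
        Function.Injective φ → Fintype.card K = Fintype.card k ^ 2 → Q₂ ≤ Fintype.card K →
        ∀ A X Y : Finset (Matrix.GeneralLinearGroup (Fin 2) K),
          IsApproximateSubgroup M (A : Set (Matrix.GeneralLinearGroup (Fin 2) K)) →
          c₁ * (Fintype.card K : ℝ) ^ 3 ≤ A.card → (A.card : ℝ) ≤ c₂ * (Fintype.card K : ℝ) ^ 3 →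
          (X.card : ℝ) ≤ M → Y.Nonempty → Finset.univ.image φ * Y ⊆ X * A →
          (A.image Matrix.GeneralLinearGroup.det).card ≤ m₀ := by
  intro M c₁ c₂ hM hc₁ hc₂
  obtain ⟨C, hC⟩ := hBGT
  obtain ⟨hC1, hC'⟩ := hC (M ^ 7)
  have hCpos : 0 < C (M ^ 7) := by linarith
  obtain ⟨m₀, Q₆, h4⟩ := hP4 M c₂ (C (M ^ 7)) hM hc₂ hCpos
  obtain ⟨Q₅, h3⟩ := subfieldCell_nonGeneration M c₁ hc₁
  refine ⟨m₀, max (max Q₅ Q₆) (⌈C (M ^ 7) / c₁⌉₊ + 2), ?_⟩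
  intro k K _ _ _ _ _ _ φ hφ hK hQ A X Y happ hlo hhi hX hYne hcov
  have hQ5 : Q₅ ≤ Fintype.card K := le_trans (le_trans (le_max_left _ _) (le_max_left _ _)) hQ
  have hQ6 : Q₆ ≤ Fintype.card K := le_trans (le_trans (le_max_right _ _) (le_max_left _ _)) hQ
  have hQ8 : ⌈C (M ^ 7) / c₁⌉₊ + 2 ≤ Fintype.card K := le_trans (le_max_right _ _) hQ
  have hQR : (⌈C (M ^ 7) / c₁⌉₊ : ℝ) + 2 ≤ (Fintype.card K : ℝ) := by exact_mod_cast hQ8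
  have hceil := Nat.le_ceil (C (M ^ 7) / c₁)
  have hceil0 : (0 : ℝ) ≤ (⌈C (M ^ 7) / c₁⌉₊ : ℝ) := Nat.cast_nonneg _
  have hQ1 : (1 : ℝ) ≤ (Fintype.card K : ℝ) := by linarith
  have hQpos : (0 : ℝ) < (Fintype.card K : ℝ) := by linarith
  -- `A` is symmetric and contains `1`
  have hsymm : (↑A : Set (Matrix.GeneralLinearGroup (Fin 2) K))⁻¹ = ↑A := happ.inv_eq_self
  have h1 : (1 : Matrix.GeneralLinearGroup (Fin 2) K) ∈ A := Finset.mem_coe.1 happ.one_mem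
  have hne : A.Nonempty := ⟨1, h1⟩
  -- `A² ∩ SL₂` is large
  have hA2 : c₁ * (Fintype.card K : ℝ) ^ 2 ≤
      (((A ^ 2).filter fun g => Matrix.GeneralLinearGroup.det g = 1).card : ℝ) := by
    have hP := hP1 K A hne hsymm
    have hP' : A.card ≤ Fintype.card K *
        ((A ^ 2).filter fun g => Matrix.GeneralLinearGroup.det g = 1).card :=
      hP.trans (Nat.mul_le_mul_right _ (Nat.sub_le _ _))
    have hP'' : (A.card : ℝ) ≤ (Fintype.card K : ℝ) *
        ((A ^ 2).filter fun g => Matrix.GeneralLinearGroup.det g = 1).card := by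
      exact_mod_cast hP'
    by_contra hlt
    rw [not_le] at hlt
    have := mul_lt_mul_of_pos_left hlt hQpos
    nlinarith
  -- `A² ∩ SL₂ ⊆ A⁴ ∩ SL₂`
  have h24 : ((A ^ 2).filter fun g => Matrix.GeneralLinearGroup.det g = 1) ⊆
      ((A ^ 4).filter fun g => Matrix.GeneralLinearGroup.det g = 1) :=
    Finset.filter_subset_filter _ (Finset.pow_subset_pow_right h1 (by norm_num))
  have hA4 : c₁ * (Fintype.card K : ℝ) ^ 2 ≤
      (((A ^ 4).filter fun g => Matrix.GeneralLinearGroup.det g = 1).card : ℝ) :=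
    hA2.trans (by exact_mod_cast Finset.card_le_card h24)
  -- `A⁴ ∩ SL₂` is an `M⁷`-approximate subgroup (Mathlib `IsApproximateSubgroup.pow_inter_pow`)
  have happ4 : IsApproximateSubgroup (M ^ 7)
      (↑((A ^ 4).filter fun g => Matrix.GeneralLinearGroup.det g = 1) :
        Set (Matrix.GeneralLinearGroup (Fin 2) K)) := by
    have hker : IsApproximateSubgroup 1
        (((Matrix.GeneralLinearGroup.det : Matrix.GeneralLinearGroup (Fin 2) K →* Kˣ).ker :
          Subgroup (Matrix.GeneralLinearGroup (Fin 2) K)) :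
          Set (Matrix.GeneralLinearGroup (Fin 2) K)) := IsApproximateSubgroup.subgroup
    have h := happ.pow_inter_pow hker (show 2 ≤ 4 by norm_num) (le_refl 2)
    have hk2 : (((Matrix.GeneralLinearGroup.det : Matrix.GeneralLinearGroup (Fin 2) K →* Kˣ).ker :
          Subgroup (Matrix.GeneralLinearGroup (Fin 2) K)) :
          Set (Matrix.GeneralLinearGroup (Fin 2) K)) ^ 2 =
        ((Matrix.GeneralLinearGroup.det : Matrix.GeneralLinearGroup (Fin 2) K →* Kˣ).ker :
          Subgroup (Matrix.GeneralLinearGroup (Fin 2) K)) := by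
      ext x
      rw [sq, Set.mem_mul]
      constructor
      · rintro ⟨a, ha, b, hb, rfl⟩
        exact mul_mem ha hb
      · intro hx
        exact ⟨x, hx, 1, one_mem _, mul_one x⟩
    have hset : (↑((A ^ 4).filter fun g => Matrix.GeneralLinearGroup.det g = 1) :
        Set (Matrix.GeneralLinearGroup (Fin 2) K)) =
        (↑A : Set (Matrix.GeneralLinearGroup (Fin 2) K)) ^ 4 ∩
          (((Matrix.GeneralLinearGroup.det : Matrix.GeneralLinearGroup (Fin 2) K →* Kˣ).ker :
            Subgroup (Matrix.GeneralLinearGroup (Fin 2) K)) :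
            Set (Matrix.GeneralLinearGroup (Fin 2) K)) ^ 2 := by
      rw [hk2, Finset.coe_filter]
      ext x
      simp only [Set.mem_setOf_eq, Set.mem_inter_iff, SetLike.mem_coe, MonoidHom.mem_ker,
        ← Finset.coe_pow]
    rw [hset]
    exact h.mono (le_of_eq (by norm_num))
  -- the generated subgroup lies in `SL₂ = ker det`
  have hdet4 : ∀ g ∈ ((A ^ 4).filter fun g => Matrix.GeneralLinearGroup.det g = 1),
      Matrix.GeneralLinearGroup.det g = 1 := fun g hg => (Finset.mem_filter.1 hg).2
  have hL4 : Subgroup.closure (↑((A ^ 4).filter fun g => Matrix.GeneralLinearGroup.det g = 1) :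
        Set (Matrix.GeneralLinearGroup (Fin 2) K)) ≤
      (Matrix.GeneralLinearGroup.det : Matrix.GeneralLinearGroup (Fin 2) K →* Kˣ).ker := by
    rw [Subgroup.closure_le]
    intro g hg
    rw [SetLike.mem_coe, MonoidHom.mem_ker]
    exact hdet4 g (Finset.mem_coe.1 hg)
  by_cases hgen : Subgroup.closure (↑((A ^ 4).filter fun g => Matrix.GeneralLinearGroup.det g = 1) :
        Set (Matrix.GeneralLinearGroup (Fin 2) K)) =
      (Matrix.GeneralLinearGroup.det : Matrix.GeneralLinearGroup (Fin 2) K →* Kˣ).ker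
  · -- generation: BGT, then sliced counting
    rcases hC' K _ hdet4 happ4 hgen with hsmall | hlarge
    · exfalso
      have hdiv : C (M ^ 7) = c₁ * (C (M ^ 7) / c₁) := by field_simp
      have hCQ : C (M ^ 7) < c₁ * (Fintype.card K : ℝ) := by
        have h1' : C (M ^ 7) / c₁ + 2 ≤ (Fintype.card K : ℝ) := by linarith
        nlinarith [h1', hc₁]
      have : c₁ * (Fintype.card K : ℝ) ≤ c₁ * (Fintype.card K : ℝ) ^ 2 := by nlinarith
      linarith [hA4, hsmall]
    · exact h4 K hQ6 A happ hhi hlarge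
  · -- a proper subgroup: a dense piece of `φ(SL₂ k)` conjugates into it; (NG) forces generation
    exfalso
    have hSne : (Finset.univ.image φ).Nonempty :=
      ⟨1, Finset.mem_image.2 ⟨1, Finset.mem_univ _, map_one φ⟩⟩
    obtain ⟨x, -, y, -, hcard, hpairs⟩ :=
      densePiece_of_subset_mul (Finset.univ.image φ) Y X A hSne hYne hcov
    set P : Finset (Matrix.SpecialLinearGroup (Fin 2) k) :=
      Finset.univ.filter (fun a : Matrix.SpecialLinearGroup (Fin 2) k => x⁻¹ * φ a * y ∈ A)
      with hPdef
    have hfilt : (Finset.univ.image φ).filter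
        (fun s : Matrix.GeneralLinearGroup (Fin 2) K => x⁻¹ * s * y ∈ A) = P.image φ := by
      ext s
      simp only [Finset.mem_filter, Finset.mem_image, Finset.mem_univ, true_and, hPdef]
      constructor
      · rintro ⟨⟨a, rfl⟩, h⟩
        exact ⟨a, h, rfl⟩
      · rintro ⟨a, h, rfl⟩
        exact ⟨⟨a, rfl⟩, h⟩
    have hPcard : (Fintype.card (Matrix.SpecialLinearGroup (Fin 2) k) : ℝ) ≤ M * P.card := by
      have h1' : Fintype.card (Matrix.SpecialLinearGroup (Fin 2) k) = (Finset.univ.image φ).card := by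
        rw [Finset.card_image_of_injective _ hφ, Finset.card_univ]
      have h2 : (Finset.univ.image φ).card ≤ X.card * P.card := by
        rw [hfilt, Finset.card_image_of_injective P hφ] at hcard
        exact hcard
      have h3' : (Fintype.card (Matrix.SpecialLinearGroup (Fin 2) k) : ℝ) ≤ (X.card : ℝ) * P.card := by
        rw [h1']
        exact_mod_cast h2
      exact h3'.trans (mul_le_mul_of_nonneg_right hX (Nat.cast_nonneg _))
    have hAinv : A⁻¹ = A := by rw [← Finset.coe_inj, Finset.coe_inv, hsymm]
    have hPL : ∀ s ∈ P, ∀ s' ∈ P, x⁻¹ * φ (s * s'⁻¹) * x ∈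
        Subgroup.closure (↑((A ^ 4).filter fun g => Matrix.GeneralLinearGroup.det g = 1) :
          Set (Matrix.GeneralLinearGroup (Fin 2) K)) := by
      intro s hs s' hs'
      have hsF : φ s ∈ (Finset.univ.image φ).filter
          (fun s : Matrix.GeneralLinearGroup (Fin 2) K => x⁻¹ * s * y ∈ A) := by
        rw [hfilt]; exact Finset.mem_image_of_mem φ hs
      have hs'F : φ s' ∈ (Finset.univ.image φ).filter
          (fun s : Matrix.GeneralLinearGroup (Fin 2) K => x⁻¹ * s * y ∈ A) := by
        rw [hfilt]; exact Finset.mem_image_of_mem φ hs'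
      have hmem : x⁻¹ * (φ s * (φ s')⁻¹) * x ∈ A * A⁻¹ := hpairs _ hsF _ hs'F
      rw [hAinv, ← sq] at hmem
      have hdet : Matrix.GeneralLinearGroup.det (x⁻¹ * (φ s * (φ s')⁻¹) * x) = 1 := by
        rw [map_mul, map_mul, map_inv, inv_mul_cancel_comm, ← map_inv, ← map_mul]
        exact Units.ext (by
          rw [Matrix.GeneralLinearGroup.val_det_apply, Units.val_one]
          exact subfieldCell_det_eq_one φ hK _)
      have hmem2 : x⁻¹ * (φ s * (φ s')⁻¹) * x ∈
          ((A ^ 2).filter fun g => Matrix.GeneralLinearGroup.det g = 1) :=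
        Finset.mem_filter.2 ⟨hmem, hdet⟩
      have e : x⁻¹ * φ (s * s'⁻¹) * x = x⁻¹ * (φ s * (φ s')⁻¹) * x := by rw [map_mul, map_inv]
      rw [e]
      exact Subgroup.subset_closure (Finset.mem_coe.2 (h24 hmem2))
    exact hgen (h3 k K φ hφ hK hQ5 _ hL4 x P hPcard hPL ⟨_, Subgroup.subset_closure, hA4⟩)

end Summit.MatrixMultiplication.MatrixMultiplication.Theorems.GradedDesignFamily.Negative
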